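import Literature.Topology.FourManifolds.HeightTwoCriticalBall
import Literature.Topology.FourManifolds.EquidimensionalEmbedding
import Literature.AlgebraicTopology.Homotopy.HomotopyGroupsGeneralPosition
import HarnessLib

/-!
# Tools for Alexander's theorem: sides of embedded spheres and counting level circles

Topic `Literature/Topology/FourManifolds`; fact seat of Alexander's theorem
(`provefact-Literature.Topology.FourManifolds.SphereEmbedding.schoenflies_exists_ball`, Schultens
(2014), Thm. 3.2.5).  **Everything in this file is proved; no definitions, no named facts.**

Three point-set tools for the bookkeeping of the induction of the printed proof (Schultens
(2014), PDF pp. 43–45), where solids `A = {F ≤ 0}` are bounded by spheres `S = {F = 0}`: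

* §1 sign of a nonvanishing function on a (possibly unbounded) preconnected set
  (`AlexanderTools.forall_pos_or_forall_neg`, `forall_pos_of_not_isBounded`) — how "inside" and
  "outside" of a sphere are certified from a defining function;
* §2 `AlexanderTools.image_ball_eq_setOf_neg`, `image_closedBall_eq_setOf_nonpos` — **the ball
  bounded by an embedded sphere is the compact side**: if `e : ℝᵏ → ℝᵏ` is a smooth embedding
  and `F` a side function (compact `{F ≤ 0}`, connected open sides) with `e(𝕊) = {F = 0}`, then
  `e(𝔹) = {F < 0}` and `e(𝔻) = {F ≤ 0}` — the step "`S₂` … bounds a 3-ball" ⇒ "the ball is the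
  region cut off" of the printed proof;
* §3 `AlexanderTools.ncard_components_lt` — a union of connected components of a set missing one
  component has fewer components (the count `#|H' ∩ S|` drops after a surgery, PDF p. 45);
* §4 `AlexanderTools.exists_euclidean_sideFunction_connected` — the Euclidean side function of
  the tree's `ExpHeight.exists_euclidean_sideFunction` with, in addition, both open sides
  `{F < 0}`, `{F > 0}` connected (Jordan–Brouwer; the positive side is the image of the punctured
  side `{g < 0} ∖ {N}` of the side package in `𝕊ᵐ⁺¹`).

## References

* J. Schultens, *Introduction to 3-Manifolds*, GSM 151 (2014), proof of Thm. 3.2.5 (PDF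
  pp. 43–45). [Schultens2014]
-/

open scoped RealInnerProductSpace Topology Manifold ContDiff
open Set Filter Metric Module Function

noncomputable section

namespace Literature.Topology.FourManifolds

namespace AlexanderTools

/-! ### §1 Sign of a nonvanishing function on a preconnected set -/

/-- A continuous function without zeros on a preconnected set has constant sign there.
[folklore] -/
theorem forall_pos_or_forall_neg {X : Type*} [TopologicalSpace X] {U : Set X}
    (hU : IsPreconnected U) {F : X → ℝ} (hF : ContinuousOn F U) (h0 : ∀ x ∈ U, F x ≠ 0) :
    (∀ x ∈ U, 0 < F x) ∨ ∀ x ∈ U, F x < 0 := by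
  by_contra h
  push Not at h
  obtain ⟨⟨a, ha, ha'⟩, ⟨b, hb, hb'⟩⟩ := h
  obtain ⟨x, hx, hx0⟩ := hU.intermediate_value₂ ha hb hF continuousOn_const ha' hb'
  exact h0 x hx hx0

/-- A preconnected set missing the zero set of `F`, and meeting `{F < 0}`, lies in `{F < 0}`.
[folklore] -/
theorem forall_neg_of_exists {X : Type*} [TopologicalSpace X] {U : Set X}
    (hU : IsPreconnected U) {F : X → ℝ} (hF : ContinuousOn F U) (h0 : ∀ x ∈ U, F x ≠ 0)
    {a : X} (ha : a ∈ U) (ha' : F a < 0) : ∀ x ∈ U, F x < 0 := by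
  rcases forall_pos_or_forall_neg hU hF h0 with h | h
  · exact absurd (h a ha) (not_lt.2 ha'.le)
  · exact h

/-- A preconnected set missing the zero set of `F`, and meeting `{F > 0}`, lies in `{F > 0}`.
[folklore] -/
theorem forall_pos_of_exists {X : Type*} [TopologicalSpace X] {U : Set X}
    (hU : IsPreconnected U) {F : X → ℝ} (hF : ContinuousOn F U) (h0 : ∀ x ∈ U, F x ≠ 0)
    {a : X} (ha : a ∈ U) (ha' : 0 < F a) : ∀ x ∈ U, 0 < F x := by
  rcases forall_pos_or_forall_neg hU hF h0 with h | h
  · exact h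
  · exact absurd (h a ha) (not_lt.2 ha'.le)

/-- **An unbounded preconnected set missing the zero set of a function with compact sublevel
set `{F ≤ 0}` lies in `{F > 0}`.** [folklore] -/
theorem forall_pos_of_not_isBounded {E : Type*} [PseudoMetricSpace E] {U : Set E}
    (hU : IsPreconnected U) (hUb : ¬ Bornology.IsBounded U) {F : E → ℝ} (hF : ContinuousOn F U)
    (h0 : ∀ x ∈ U, F x ≠ 0) (hK : IsCompact {x | F x ≤ 0}) : ∀ x ∈ U, 0 < F x := by
  obtain ⟨a, haU, haK⟩ : ∃ a ∈ U, a ∉ {x | F x ≤ 0} := by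
    by_contra h
    push Not at h
    exact hUb (hK.isBounded.subset h)
  exact forall_pos_of_exists hU hF h0 haU (not_le.1 haK)

/-! ### §2 The ball bounded by an embedded sphere is the compact side -/

section Ball

variable {k : ℕ}

/-- **The image of the open unit ball under a smooth embedding `e : ℝᵏ → ℝᵏ` whose boundary
sphere is the zero set of a side function `F` (compact sublevel set, connected open sides) is
the negative side `{F < 0}`.**  The image is open (invariance of domain for local
diffeomorphisms), connected and misses `{F = 0}`, so it lies in one open side; it cannot lie in
the unbounded connected side `{F > 0}` (which it would disconnect from infinity), and the
connected side `{F < 0}` cannot leave the closed image `e(𝔻)`. [folklore] -/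
theorem image_ball_eq_setOf_neg (hk : k ≠ 0)
    {e : EuclideanSpace ℝ (Fin k) → EuclideanSpace ℝ (Fin k)}
    (he : Manifold.IsSmoothEmbedding 𝓘(ℝ, EuclideanSpace ℝ (Fin k))
      𝓘(ℝ, EuclideanSpace ℝ (Fin k)) ∞ e)
    {F : EuclideanSpace ℝ (Fin k) → ℝ} (hFc : Continuous F) (hK : IsCompact {x | F x ≤ 0})
    (hZ : e '' sphere 0 1 = {x | F x = 0}) (hpos : IsConnected {x | 0 < F x})
    (hneg : IsConnected {x | F x < 0}) : e '' ball 0 1 = {x | F x < 0} := by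
  haveI : Nontrivial (EuclideanSpace ℝ (Fin k)) := by
    haveI : Nonempty (Fin k) := ⟨⟨0, Nat.pos_of_ne_zero hk⟩⟩
    infer_instance
  have hec : Continuous e := he.contMDiff.continuous
  have heinj : Injective e := he.isEmbedding.injective
  have hopen : IsOpenMap e := (he.isLocalDiffeomorph_of_finrank_eq rfl).isOpenMap
  set U := e '' ball 0 1 with hU
  set D := e '' closedBall (0 : EuclideanSpace ℝ (Fin k)) 1 with hD
  have hUo : IsOpen U := hopen _ isOpen_ball
  have hUc : IsConnected U :=
    ((convex_ball (0 : EuclideanSpace ℝ (Fin k)) 1).isConnected ⟨0, mem_ball_self one_pos⟩).image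
      e hec.continuousOn
  have hDc : IsCompact D := (isCompact_closedBall 0 1).image hec
  have hDcl : IsClosed D := hDc.isClosed
  -- no zeros on `U`
  have hU0 : ∀ x ∈ U, F x ≠ 0 := by
    rintro _ ⟨y, hy, rfl⟩ h0
    have : e y ∈ e '' sphere 0 1 := by rw [hZ]; exact h0
    obtain ⟨z, hz, hzy⟩ := this
    rw [heinj hzy] at hz
    rw [mem_ball_zero_iff] at hy
    rw [mem_sphere_zero_iff_norm] at hz
    linarith
  -- `D = U ∪ Z`
  have hDU : D = U ∪ {x | F x = 0} := by
    rw [hD, ← hZ, ← image_union, ← closedBall_sdiff_sphere, sdiff_union_self,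
      union_eq_left.2 sphere_subset_closedBall]
  -- a point far away
  obtain ⟨p, hp⟩ : ∃ p, p ∉ {x | F x ≤ 0} ∪ D := by
    by_contra h
    push Not at h
    exact NormedSpace.unbounded_univ ℝ (EuclideanSpace ℝ (Fin k))
      ((hK.union hDc).isBounded.subset fun x _ => h x)
  have hpF : 0 < F p := not_le.1 fun h => hp (Or.inl h)
  have hpD : p ∉ D := fun h => hp (Or.inr h)
  -- `U ⊆ {F < 0}`
  have hUneg : ∀ x ∈ U, F x < 0 := by
    rcases forall_pos_or_forall_neg hUc.isPreconnected hFc.continuousOn hU0 with h | h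
    · exfalso
      -- `{F > 0} = U ⊔ ({F > 0} ∖ D)` would be disconnected
      set W := {x | 0 < F x} \ D with hW
      have hWo : IsOpen W := (isOpen_lt continuous_const hFc).sdiff hDcl
      have hcover : {x | 0 < F x} ⊆ U ∪ W := by
        intro x hx
        by_cases hxD : x ∈ D
        · rw [hDU] at hxD
          rcases hxD with hxU | hx0
          · exact Or.inl hxU
          · exact absurd hx0 (ne_of_gt hx)
        · exact Or.inr ⟨hx, hxD⟩
      have h1 : ({x | 0 < F x} ∩ U).Nonempty :=
        ⟨e 0, h _ ⟨0, mem_ball_self one_pos, rfl⟩, ⟨0, mem_ball_self one_pos, rfl⟩⟩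
      have h2 : ({x | 0 < F x} ∩ W).Nonempty := ⟨p, hpF, hpF, hpD⟩
      obtain ⟨x, -, hxU, hxW⟩ := hpos.isPreconnected U W hUo hWo hcover h1 h2
      exact hxW.2 (by rw [hDU]; exact Or.inl hxU)
    · exact h
  -- `{F < 0} ⊆ U`
  refine Subset.antisymm (fun x hx => hUneg x hx) fun x hx => ?_
  by_contra hxU
  set W := {x | F x < 0} \ D with hW
  have hWo : IsOpen W := (isOpen_lt hFc continuous_const).sdiff hDcl
  have hcover : {x | F x < 0} ⊆ U ∪ W := by
    intro y hy
    by_cases hyD : y ∈ D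
    · rw [hDU] at hyD
      rcases hyD with hyU | hy0
      · exact Or.inl hyU
      · exact absurd hy0 (ne_of_lt hy)
    · exact Or.inr ⟨hy, hyD⟩
  have hxD : x ∉ D := by
    intro hxD
    rw [hDU] at hxD
    rcases hxD with hxU' | hx0
    · exact hxU hxU'
    · exact absurd hx0 (ne_of_lt hx)
  have h1 : ({x | F x < 0} ∩ U).Nonempty :=
    ⟨e 0, hUneg _ ⟨0, mem_ball_self one_pos, rfl⟩, ⟨0, mem_ball_self one_pos, rfl⟩⟩
  have h2 : ({x | F x < 0} ∩ W).Nonempty := ⟨x, hx, hx, hxD⟩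
  obtain ⟨y, -, hyU, hyW⟩ := hneg.isPreconnected U W hUo hWo hcover h1 h2
  exact hyW.2 (by rw [hDU]; exact Or.inl hyU)

/-- **The closed ball bounded by the embedded sphere is the compact side `{F ≤ 0}`.**
[folklore] -/
theorem image_closedBall_eq_setOf_nonpos (hk : k ≠ 0)
    {e : EuclideanSpace ℝ (Fin k) → EuclideanSpace ℝ (Fin k)}
    (he : Manifold.IsSmoothEmbedding 𝓘(ℝ, EuclideanSpace ℝ (Fin k))
      𝓘(ℝ, EuclideanSpace ℝ (Fin k)) ∞ e)
    {F : EuclideanSpace ℝ (Fin k) → ℝ} (hFc : Continuous F) (hK : IsCompact {x | F x ≤ 0})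
    (hZ : e '' sphere 0 1 = {x | F x = 0}) (hpos : IsConnected {x | 0 < F x})
    (hneg : IsConnected {x | F x < 0}) : e '' closedBall 0 1 = {x | F x ≤ 0} := by
  have h : closedBall (0 : EuclideanSpace ℝ (Fin k)) 1 = ball 0 1 ∪ sphere 0 1 := by
    rw [← closedBall_sdiff_sphere, sdiff_union_self, union_eq_left.2 sphere_subset_closedBall]
  rw [h, image_union, image_ball_eq_setOf_neg hk he hFc hK hZ hpos hneg, hZ]
  ext x
  simp only [mem_union, mem_setOf_eq]
  constructor
  · rintro (h | h)
    · exact h.le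
    · exact h.le
  · intro h
    rcases h.lt_or_eq with h | h
    · exact Or.inl h
    · exact Or.inr h

end Ball

/-! ### §3 Counting connected components: a proper sub-union of components has fewer -/

section Components

variable {X : Type*} [TopologicalSpace X]

/-- If `T ⊆ S` is a union of connected components of `S` then the components of `T` are
components of `S`. [folklore] -/
theorem connectedComponentIn_eq_of_subset {S T : Set X} (hTS : T ⊆ S)
    (hT : ∀ x ∈ T, connectedComponentIn S x ⊆ T) {t : X} (ht : t ∈ T) :
    connectedComponentIn T t = connectedComponentIn S t := by
  refine Subset.antisymm (connectedComponentIn_mono t hTS) ?_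
  exact isPreconnected_connectedComponentIn.subset_connectedComponentIn
    (mem_connectedComponentIn (hTS ht)) (hT t ht)

/-- **A union of connected components of `S` missing one component has fewer components**
(counted as the finite set of components). [folklore] -/
theorem ncard_components_lt {S T : Set X} (hTS : T ⊆ S)
    (hT : ∀ x ∈ T, connectedComponentIn S x ⊆ T) {x₀ : X} (hx₀ : x₀ ∈ S) (hx₀T : x₀ ∉ T)
    (hfin : {C : Set X | ∃ x ∈ S, C = connectedComponentIn S x}.Finite) :
    {C : Set X | ∃ x ∈ T, C = connectedComponentIn T x}.ncard <
      {C : Set X | ∃ x ∈ S, C = connectedComponentIn S x}.ncard := by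
  refine Set.ncard_lt_ncard ⟨?_, ?_⟩ hfin
  · rintro C ⟨t, ht, rfl⟩
    exact ⟨t, hTS ht, connectedComponentIn_eq_of_subset hTS hT ht⟩
  · intro hsub
    obtain ⟨t, ht, hC⟩ := hsub ⟨x₀, hx₀, rfl⟩
    rw [connectedComponentIn_eq_of_subset hTS hT ht] at hC
    have : x₀ ∈ connectedComponentIn S t := by rw [← hC]; exact mem_connectedComponentIn hx₀
    exact hx₀T (hT t ht this)

/-- The components of a sub-union of components are among the components. [folklore] -/
theorem components_subset {S T : Set X} (hTS : T ⊆ S)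
    (hT : ∀ x ∈ T, connectedComponentIn S x ⊆ T) :
    {C : Set X | ∃ x ∈ T, C = connectedComponentIn T x} ⊆
      {C : Set X | ∃ x ∈ S, C = connectedComponentIn S x} := by
  rintro C ⟨t, ht, rfl⟩
  exact ⟨t, hTS ht, connectedComponentIn_eq_of_subset hTS hT ht⟩

end Components

/-! ### §4 The Euclidean side function with connected sides -/

section Side

variable {m : ℕ}

/-- **A Euclidean side function with connected sides.**  For a smooth embedding
`f : 𝕊ᵐ → ℝᵐ⁺¹`, `m ≥ 1`, there is a smooth `F : ℝᵐ⁺¹ → ℝ` with zero set `range f`,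
nonvanishing derivative there, compact sublevel set `{F ≤ 0}`, `{F < 0} ≠ ∅`, and BOTH open
sides `{F < 0}`, `{F > 0}` connected (Jordan–Brouwer separation for smooth hypersurface
spheres).  Same construction as the tree's `ExpHeight.exists_euclidean_sideFunction` (read `f`
in `𝕊ᵐ⁺¹` through the inverse stereographic projection from a pole `N`, take a side package
`g` with `g N < 0`, pull back `-g`), keeping the connectedness of the two sides of the side
package: `{F < 0}` is the image of `{g > 0}`, and `{F > 0}` the image of `{g < 0} ∖ {N}`, which
is still connected (a point does not disconnect an open connected subset of a manifold of
dimension `≥ 2`). [folklore] -/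
theorem exists_euclidean_sideFunction_connected (hm : 1 ≤ m)
    {f : Metric.sphere (0 : EuclideanSpace ℝ (Fin (m + 1))) 1 → EuclideanSpace ℝ (Fin (m + 1))}
    (hf : Manifold.IsSmoothEmbedding (𝓡 m) 𝓘(ℝ, EuclideanSpace ℝ (Fin (m + 1))) ∞ f) :
    ∃ F : EuclideanSpace ℝ (Fin (m + 1)) → ℝ, ContDiff ℝ ∞ F ∧ (∀ x, F x = 0 ↔ x ∈ range f) ∧
      (∀ x, F x = 0 → fderiv ℝ F x ≠ 0) ∧ IsCompact {x | F x ≤ 0} ∧ (∃ x, F x < 0) ∧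
      IsConnected {x | F x < 0} ∧ IsConnected {x | 0 < F x} := by
  haveI : Fact (finrank ℝ (EuclideanSpace ℝ (Fin (m + 1 + 1))) = m + 1 + 1) :=
    ⟨finrank_euclideanSpace_fin⟩
  -- the pole and the stereographic chart
  set N : Metric.sphere (0 : EuclideanSpace ℝ (Fin (m + 1 + 1))) 1 :=
    ⟨EuclideanSpace.single 0 1, by simp⟩ with hN
  set σ := stereographic' (m + 1) N with hσ
  have hsrc : σ.source = {N}ᶜ := stereographic'_source N
  have htgt : σ.target = univ := stereographic'_target N
  have hatlas : σ ∈ IsManifold.maximalAtlas (𝓡 (m + 1)) ∞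
      (Metric.sphere (0 : EuclideanSpace ℝ (Fin (m + 1 + 1))) 1) :=
    IsManifold.subset_maximalAtlas (stereographic'_mem_atlas N)
  have hσs : ContMDiffOn (𝓡 (m + 1)) (𝓡 (m + 1)) ∞ σ σ.source :=
    contMDiffOn_of_mem_maximalAtlas hatlas
  have hσs' : ContMDiffOn (𝓡 (m + 1)) (𝓡 (m + 1)) ∞ σ.symm σ.target :=
    contMDiffOn_symm_of_mem_maximalAtlas hatlas
  have hsymm_src : ∀ y, y ∈ σ.symm.source := fun y => by
    rw [σ.symm_source, htgt]; exact mem_univ _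
  have hσsymm : ContMDiff 𝓘(ℝ, EuclideanSpace ℝ (Fin (m + 1))) (𝓡 (m + 1)) ∞ σ.symm := by
    have := hσs'
    rw [htgt, contMDiffOn_univ] at this
    exact this
  -- `f' = σ⁻¹ ∘ f` is a smooth embedding into the sphere, missing `N`
  set f' := σ.symm ∘ f with hf'
  have hf'emb : Manifold.IsSmoothEmbedding (𝓡 m) (𝓡 (m + 1)) ∞ f' := by
    refine ⟨hf.isImmersion.openPartialHomeomorph_comp σ.symm ?_ ?_ (fun x => hsymm_src (f x)), ?_⟩
    · rw [σ.symm_source]; exact hσs'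
    · rw [σ.symm_symm, σ.symm_target]; exact hσs
    · exact (isSmoothEmbedding_stereographic'_symm N).isEmbedding.comp hf.isEmbedding
  have hNf' : N ∉ range f' := by
    rintro ⟨x, hx⟩
    have : σ.symm (f x) ∈ σ.source := σ.map_target (by rw [htgt]; exact mem_univ _)
    rw [hsrc, mem_compl_singleton_iff] at this
    exact this hx
  -- the side function with `N` on the positive side of `F`
  obtain ⟨g, hg, hgN⟩ := SphereHypersurfaceSides.exists_isSidePackage_neg hm hf'emb hNf'
  have hg' := hg.neg
  set F : EuclideanSpace ℝ (Fin (m + 1)) → ℝ := fun x => -g (σ.symm x) with hF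
  have hgs : ContMDiff (𝓡 (m + 1)) 𝓘(ℝ, ℝ) ∞ g := hg.isRegularLevel.contMDiff
  have hFs : ContDiff ℝ ∞ F := by
    rw [← contMDiff_iff_contDiff]
    exact (contDiff_neg.contMDiff.comp hgs).comp hσsymm
  -- zero set
  have hzero : ∀ x, F x = 0 ↔ x ∈ range f := by
    intro x
    simp only [hF, neg_eq_zero]
    have h1 : g (σ.symm x) = 0 ↔ σ.symm x ∈ range f' := by
      rw [← hg.preimage_zero]; rfl
    rw [h1]
    constructor
    · rintro ⟨y, hy⟩
      refine ⟨y, σ.symm.injOn (hsymm_src _) (hsymm_src _) ?_⟩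
      exact hy
    · rintro ⟨y, rfl⟩
      exact ⟨y, rfl⟩
  -- regularity
  have hregF : ∀ x, F x = 0 → fderiv ℝ F x ≠ 0 := by
    intro x hx hDF
    have hx0 : g (σ.symm x) = 0 := by simpa [hF] using hx
    have hσd : (σ.symm).MDifferentiable (𝓡 (m + 1)) (𝓡 (m + 1)) :=
      (mdifferentiable_of_mem_atlas (I := 𝓡 (m + 1)) (stereographic'_mem_atlas N)).symm
    have hsurj : Function.Surjective (mfderiv 𝓘(ℝ, EuclideanSpace ℝ (Fin (m + 1))) (𝓡 (m + 1))
        σ.symm x) := hσd.mfderiv_surjective (hsymm_src x)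
    have hgd : MDifferentiableAt (𝓡 (m + 1)) 𝓘(ℝ, ℝ) (fun z => -g z) (σ.symm x) :=
      (hg'.isRegularLevel.contMDiff.mdifferentiableAt (by simp))
    have hcomp : mfderiv 𝓘(ℝ, EuclideanSpace ℝ (Fin (m + 1))) 𝓘(ℝ, ℝ) F x =
        (mfderiv (𝓡 (m + 1)) 𝓘(ℝ, ℝ) (fun z => -g z) (σ.symm x)).comp
          (mfderiv 𝓘(ℝ, EuclideanSpace ℝ (Fin (m + 1))) (𝓡 (m + 1)) σ.symm x) :=
      mfderiv_comp x hgd (hσd.mdifferentiableAt (hsymm_src x))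
    rw [mfderiv_eq_fderiv, hDF] at hcomp
    have hzero' : mfderiv (𝓡 (m + 1)) 𝓘(ℝ, ℝ) (fun z => -g z) (σ.symm x) = 0 := by
      ext u
      obtain ⟨w, rfl⟩ := hsurj u
      have := congrArg (fun T : EuclideanSpace ℝ (Fin (m + 1)) →L[ℝ] ℝ => T w) hcomp
      rw [zero_apply] at this
      exact this.symm
    exact hg'.isRegularLevel.not_isMCriticalPt (by simp [hx0]) hzero'
  -- images under `σ` of subsets of the sphere missing `N`
  have himage : ∀ S : Set (Metric.sphere (0 : EuclideanSpace ℝ (Fin (m + 1 + 1))) 1), N ∉ S →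
      {x | σ.symm x ∈ S} = σ '' S := by
    intro S hNS
    ext x
    simp only [mem_setOf_eq, mem_image]
    constructor
    · intro hx
      exact ⟨σ.symm x, hx, σ.right_inv (by rw [htgt]; exact mem_univ _)⟩
    · rintro ⟨z, hz, rfl⟩
      have hzN : z ≠ N := by rintro rfl; exact hNS hz
      rw [σ.left_inv (by rw [hsrc]; exact hzN)]
      exact hz
  have hσcont : ∀ S : Set (Metric.sphere (0 : EuclideanSpace ℝ (Fin (m + 1 + 1))) 1), N ∉ S →
      ContinuousOn σ S := fun S hNS => σ.continuousOn.mono fun z hz => by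
    rw [hsrc, mem_compl_singleton_iff]
    rintro rfl
    exact hNS hz
  -- the compact side
  have hside : {x | F x ≤ 0} = σ '' {z | 0 ≤ g z} := by
    rw [← himage _ (by simp only [mem_setOf_eq, not_le]; exact hgN)]
    ext x
    simp [hF]
  have hKc : IsCompact {x | F x ≤ 0} := by
    rw [hside]
    have hcl : IsClosed {z : Metric.sphere (0 : EuclideanSpace ℝ (Fin (m + 1 + 1))) 1 | 0 ≤ g z} :=
      isClosed_le continuous_const hgs.continuous
    exact hcl.isCompact.image_of_continuousOn (hσcont _ (by simp only [mem_setOf_eq, not_le]; exact hgN))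
  -- the negative side `{F < 0} = σ({g > 0})`
  have hnegside : {x | F x < 0} = σ '' {z | 0 < g z} := by
    rw [← himage _ (by simp only [mem_setOf_eq, not_lt]; exact hgN.le)]
    ext x
    simp [hF]
  have hnegc : IsConnected {x | F x < 0} := by
    rw [hnegside]
    exact hg.isConnected_pos.image σ (hσcont _ (by simp only [mem_setOf_eq, not_lt]; exact hgN.le))
  -- the positive side `{F > 0} = σ({g < 0} ∖ {N})`
  have hposside : {x | 0 < F x} = σ '' ({z | g z < 0} \ {N}) := by
    rw [← himage _ (fun h => h.2 rfl)]
    ext x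
    simp only [hF, mem_setOf_eq, Left.neg_pos_iff, Set.mem_sdiff, mem_singleton_iff, iff_self_and]
    intro _ h
    have : σ.symm x ∈ σ.source := σ.map_target (by rw [htgt]; exact mem_univ _)
    rw [hsrc] at this
    exact this h
  have hposc : IsConnected {x | 0 < F x} := by
    rw [hposside]
    -- `{g < 0} ∖ {N}` is connected: puncture the open connected submanifold `{g < 0}`
    haveI := ChartedSpace.locallyPathConnectedSpace (EuclideanSpace ℝ (Fin (m + 1)))
      (Metric.sphere (0 : EuclideanSpace ℝ (Fin (m + 1 + 1))) 1)
    set U : TopologicalSpace.Opens (Metric.sphere (0 : EuclideanSpace ℝ (Fin (m + 1 + 1))) 1) :=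
      ⟨{z | g z < 0}, isOpen_lt hgs.continuous continuous_const⟩ with hU
    have hUpc : IsPathConnected (U : Set (Metric.sphere (0 : EuclideanSpace ℝ (Fin (m + 1 + 1))) 1)) :=
      (U.isOpen.isConnected_iff_isPathConnected).1 hg.isConnected_neg
    haveI : PathConnectedSpace U := (isPathConnected_iff_pathConnectedSpace).1 hUpc
    have hNU : N ∈ U := hgN
    have hpunct := Literature.AlgebraicTopology.Homotopy.isPathConnected_compl_singleton_of_chartedSpace
      (E := EuclideanSpace ℝ (Fin (m + 1))) (M := U)
      (by rw [finrank_euclideanSpace_fin]; omega) ⟨N, hNU⟩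
    have himg : Subtype.val '' ({⟨N, hNU⟩}ᶜ : Set U) = {z | g z < 0} \ {N} := by
      ext z
      simp only [mem_image, mem_compl_iff, mem_singleton_iff, Subtype.exists, exists_and_right,
        exists_eq_right, Set.mem_sdiff, mem_setOf_eq]
      constructor
      · rintro ⟨hz, hzN⟩
        exact ⟨hz, fun h => hzN (Subtype.ext h)⟩
      · rintro ⟨hz, hzN⟩
        exact ⟨hz, fun h => hzN (congrArg Subtype.val h)⟩
    have hconn : IsConnected ({z | g z < 0} \ {N}) := by
      rw [← himg]
      exact (hpunct.image continuous_subtype_val).isConnected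
    exact hconn.image σ (hσcont _ (fun h => h.2 rfl))
  -- nonempty interior
  obtain ⟨x, hx⟩ := hnegc.nonempty
  exact ⟨F, hFs, hzero, hregF, hKc, ⟨x, hx⟩, hnegc, hposc⟩

end Side

end AlexanderTools

end Literature.Topology.FourManifolds

end
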